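import Summits.ResolutionOfSingularities.ResolutionOfSingularities.Theorems.FrobeniusClosingPatchingRelPerfectDepthPhaseCOneFrontEnd
import Summits.ResolutionOfSingularities.ResolutionOfSingularities.Theorems.FrobeniusClosingPatchingRelPerfectDepthPhaseCX3DefsPieces
import Summits.ResolutionOfSingularities.ResolutionOfSingularities.Theorems.FrobeniusClosingPatchingRelPerfectDepthPhaseCX3DefsContact
import Summits.ResolutionOfSingularities.ResolutionOfSingularities.Theorems.FrobeniusClosingPatchingRelPerfectDepthPhaseCReachDim
import HarnessLib

/-!
# Crux `PatchingRelPerfect` (stmt-ResolutionOfSingularities-16161), chain W5.2 — F7(β) (β-AX) X3 C-I: THE ASSEMBLY BY NAME OVER THE CONTACT CURE —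
# `PhaseCOne CylReach` from `LocallyMonomialGame`, `ContactCure₃Pw`, and ONE contact piece per reachable state

[OURS · L1 W5.2 · RECORD R13-2 / CHAIN v2.22 (res-L1-w52-lead-1 g6).]  Replaces the role of NO printed item; NOT a statement of the manuscript under
review (AI-written; AI review weaker than expert review; counted 0).  Def-free composition.  With the POINTWISE-CARRIER contact form
(`X3LemmaM.HasContactFormOnPw`, one carrier LIST, pointwise data) a reachable state needs only ONE piece: `P :=` the closed set N⁺ (non-END locus
∪ Sing Sfc ∪ (Sfc ∩ B), K23′) — the pieces bridge΄s disjointness is then vacuous and the cure is ONE call of `X3LemmaM.ContactCure₃Pw` (one F-60 call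
in the 4-fold per state); the dimension binder K21 is `ChainW52F7BetaRP.CylReach.krullDimLE_four` (res-D-pv-021, …ReachDim).

* `phaseCOne_cylReach_of_contactCure (hLMG : LocallyMonomialGame) (hCC : ContactCure₃Pw) (hPiece : per reachable format-snc state ∃ 𝓛₀ P,
  P ⊆ cosupp K♭ ∧ END of K♭ off P w.r.t. 𝓛₀ ∧ HasContactFormOnPw S P) : PhaseCOne CylReach`;
* `phaseCOne_cylReach_of_contactCure'` — the same over the carrier-GUARDED form `HasContactFormOnPw'` / `ContactCure₃Pw'` (targets of record, rev 2).

So the β-AX d = 2 term is `betaTwoAtomConclusion₂_of_phaseCOne_cylReach hCJS (phaseCOne_cylReach_of_contactCure hLMG (hRed hF60) hPiece)` with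
`hRed : ContactCureReduction₃Pw` (res-D-repro-1 AS res-L1-repro-3), `hLMG` from (G-T) via (G-A) (res-D-pv-046), `hPiece` the per-state CONTACT
CLASSIFICATION (front-end: letters 𝓛₀, the piece N⁺, END off it, the contact form along it), `hF60 : CossartJannsenSaito2020EmbeddedSequenceBoundary`,
`hCJS : CossartJannsenSaito2020EmbeddedSequenceB` (⊆ F-60).

## References
* V. Cossart, U. Jannsen, S. Saito, arXiv:0905.2191v2 (2020), Thm. 1.4. [CossartJannsenSaito2020]
* J. Kollár, *Lectures on Resolution of Singularities* (2007), (3.111) Step 3. [Kollar2007]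
-/

-- `Summit.<Summit>.<Sub>.Theorems` with `Sub = Summit` (single-conjunct summit, D-0017)
set_option linter.dupNamespace false

noncomputable section

namespace Summit.ResolutionOfSingularities.ResolutionOfSingularities.Theorems.X3LemmaM

open CategoryTheory AlgebraicGeometry TopologicalSpace IsLocalRing
open Literature.AlgebraicGeometry.Resolution
open Scheme.IdealSheafData
open Summit.ResolutionOfSingularities.ResolutionOfSingularities.Theorems.DepthMultiHost
open Summit.ResolutionOfSingularities.ResolutionOfSingularities.Theorems.ChainW52F7BetaRP

universe u

/-- [OURS · L1 W5.2 · F7(β) (β-AX) X3 C-I] **`PhaseCOne CylReach` FROM THE LOCALLY-MONOMIAL GAME, THE CONTACT CURE AND ONE CONTACT PIECE PER STATE.**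
For every reachable cylinder state, format-snc on `cyl.V`: a global letter list `𝓛₀` and ONE closed piece `P ⊆ cosupp K♭` such that `K♭` is locally
END off `P` w.r.t. `𝓛₀` and is in contact form along `P` (`HasContactFormOnPw S P`); then `ContactCure₃Pw` cures `P` on every open around it (K21 by
`CylReach.krullDimLE_four`), the pieces bridge (one piece) makes the total transform `GoodEnd`, and (A) finishes with the engine.
[cite: Kollar2007, (3.111) Step 3] [cite: CossartJannsenSaito2020, Thm. 1.4] -/
theorem phaseCOne_cylReach_of_contactCure (hLMG : LocallyMonomialGame.{u}) (hCC : ContactCure₃Pw.{u})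
    (hPiece : ∀ {X : Scheme.{u}} [IsNoetherian X], Scheme.IsRegular X → Scheme.IsExcellent X →
      ∀ (S : MultiHostState X) (cyl : CylState S) [IsIntegral cyl.Z] [IsNoetherian cyl.Z], Scheme.IsRegular cyl.Z → S.n ≠ 0 →
      ∀ (𝓒 : List X.IdealSheafData) (𝓗 : Fin S.n → List (X.IdealSheafData × ℕ)), S.IsFormatSncOn cyl.V 𝓒 𝓗 → CylReach S cyl →
      ∃ (𝓛₀ : List X.IdealSheafData) (P : Closeds X), (P : Set X) ⊆ (S.residual.K.support : Set X) ∧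
        (∀ x ∈ (S.residual.K.support : Set X), x ∉ (P : Set X) → IsEndNear S.residual.K 𝓛₀ x) ∧ HasContactFormOnPw S (P : Set X)) :
    PhaseCOne CylReach.{u} :=
  phaseCOne_cylReach_of_frontEnd hLMG fun hX hXe S cyl _ _ hZreg hn 𝓒 𝓗 hfmt hreach => by
    obtain ⟨𝓛₀, P, hPK, hend, hform⟩ := hPiece hX hXe S cyl hZreg hn 𝓒 𝓗 hfmt hreach
    refine ⟨𝓛₀, 1, fun _ => P, fun i k hik => absurd (Subsingleton.elim i k) hik, fun _ => hPK,
      fun x hx hxP => hend x hx (hxP 0), fun i U hPU _ => ?_⟩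
    exact hCC _ hX hXe hreach.krullDimLE_four S P hPK hform U hPU


/-- [OURS · L1 W5.2 · F7(β) (β-AX) X3 C-I] **THE SAME ASSEMBLY OVER THE GUARDED CONTACT FORM (targets of record, rev 2)**: `PhaseCOne CylReach` from
`LocallyMonomialGame`, `ContactCure₃Pw'` and, per reachable format-snc state, one closed piece in contact form `HasContactFormOnPw'` (the carrier-guarded
pointwise form, …X3DefsPieces §2, res-L1-w52-tri-2 21:30:55Z) off which `K♭` is locally END. [cite: Kollar2007, (3.111) Step 3]
[cite: CossartJannsenSaito2020, Thm. 1.4] -/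
theorem phaseCOne_cylReach_of_contactCure' (hLMG : LocallyMonomialGame.{u}) (hCC : ContactCure₃Pw'.{u})
    (hPiece : ∀ {X : Scheme.{u}} [IsNoetherian X], Scheme.IsRegular X → Scheme.IsExcellent X →
      ∀ (S : MultiHostState X) (cyl : CylState S) [IsIntegral cyl.Z] [IsNoetherian cyl.Z], Scheme.IsRegular cyl.Z → S.n ≠ 0 →
      ∀ (𝓒 : List X.IdealSheafData) (𝓗 : Fin S.n → List (X.IdealSheafData × ℕ)), S.IsFormatSncOn cyl.V 𝓒 𝓗 → CylReach S cyl →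
      ∃ (𝓛₀ : List X.IdealSheafData) (P : Closeds X), (P : Set X) ⊆ (S.residual.K.support : Set X) ∧
        (∀ x ∈ (S.residual.K.support : Set X), x ∉ (P : Set X) → IsEndNear S.residual.K 𝓛₀ x) ∧ HasContactFormOnPw' S (P : Set X)) :
    PhaseCOne CylReach.{u} :=
  phaseCOne_cylReach_of_frontEnd hLMG fun hX hXe S cyl _ _ hZreg hn 𝓒 𝓗 hfmt hreach => by
    obtain ⟨𝓛₀, P, hPK, hend, hform⟩ := hPiece hX hXe S cyl hZreg hn 𝓒 𝓗 hfmt hreach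
    refine ⟨𝓛₀, 1, fun _ => P, fun i k hik => absurd (Subsingleton.elim i k) hik, fun _ => hPK,
      fun x hx hxP => hend x hx (hxP 0), fun i U hPU _ => ?_⟩
    exact hCC _ hX hXe hreach.krullDimLE_four S P hPK hform U hPU

/-- [OURS · L1 W5.2 · F7(β) (β-AX) X3 C-I] **THE SAME ASSEMBLY OVER THE rev-3 CONTACT FORM (carrier guards + stalkwise principal entries; targets of record, rev 3, typing flag K26)**: `PhaseCOne CylReach` from
`LocallyMonomialGame`, `ContactCure₃Pw₃` and, per reachable format-snc state, one closed piece in contact form `HasContactFormOnPw₃` (…X3DefsPieces §3) off which `K♭` is locally END. [cite: Kollar2007, (3.111) Step 3]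
[cite: CossartJannsenSaito2020, Thm. 1.4] -/
theorem phaseCOne_cylReach_of_contactCure₃ (hLMG : LocallyMonomialGame.{u}) (hCC : ContactCure₃Pw₃.{u})
    (hPiece : ∀ {X : Scheme.{u}} [IsNoetherian X], Scheme.IsRegular X → Scheme.IsExcellent X →
      ∀ (S : MultiHostState X) (cyl : CylState S) [IsIntegral cyl.Z] [IsNoetherian cyl.Z], Scheme.IsRegular cyl.Z → S.n ≠ 0 →
      ∀ (𝓒 : List X.IdealSheafData) (𝓗 : Fin S.n → List (X.IdealSheafData × ℕ)), S.IsFormatSncOn cyl.V 𝓒 𝓗 → CylReach S cyl →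
      ∃ (𝓛₀ : List X.IdealSheafData) (P : Closeds X), (P : Set X) ⊆ (S.residual.K.support : Set X) ∧
        (∀ x ∈ (S.residual.K.support : Set X), x ∉ (P : Set X) → IsEndNear S.residual.K 𝓛₀ x) ∧ HasContactFormOnPw₃ S (P : Set X)) :
    PhaseCOne CylReach.{u} :=
  phaseCOne_cylReach_of_frontEnd hLMG fun hX hXe S cyl _ _ hZreg hn 𝓒 𝓗 hfmt hreach => by
    obtain ⟨𝓛₀, P, hPK, hend, hform⟩ := hPiece hX hXe S cyl hZreg hn 𝓒 𝓗 hfmt hreach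
    refine ⟨𝓛₀, 1, fun _ => P, fun i k hik => absurd (Subsingleton.elim i k) hik, fun _ => hPK,
      fun x hx hxP => hend x hx (hxP 0), fun i U hPU _ => ?_⟩
    exact hCC _ hX hXe hreach.krullDimLE_four S P hPK hform U hPU

/-- [OURS · L1 W5.2 · F7(β) (β-AX) X3 C-I] **THE SAME ASSEMBLY OVER THE rev-5 CONTACT FORM (carrier guards, stalkwise principal entries, carrier not a member even at the stalk; TARGETS OF RECORD, rev 5)**: `PhaseCOne CylReach` from
`LocallyMonomialGame`, `ContactCure₃Pw₅` and, per reachable format-snc state, one closed piece in contact form `HasContactFormOnPw₅` (…X3DefsPieces §5) off which `K♭` is locally END. [cite: Kollar2007, (3.111) Step 3]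
[cite: CossartJannsenSaito2020, Thm. 1.4] -/
theorem phaseCOne_cylReach_of_contactCure₅ (hLMG : LocallyMonomialGame.{u}) (hCC : ContactCure₃Pw₅.{u})
    (hPiece : ∀ {X : Scheme.{u}} [IsNoetherian X], Scheme.IsRegular X → Scheme.IsExcellent X →
      ∀ (S : MultiHostState X) (cyl : CylState S) [IsIntegral cyl.Z] [IsNoetherian cyl.Z], Scheme.IsRegular cyl.Z → S.n ≠ 0 →
      ∀ (𝓒 : List X.IdealSheafData) (𝓗 : Fin S.n → List (X.IdealSheafData × ℕ)), S.IsFormatSncOn cyl.V 𝓒 𝓗 → CylReach S cyl →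
      ∃ (𝓛₀ : List X.IdealSheafData) (P : Closeds X), (P : Set X) ⊆ (S.residual.K.support : Set X) ∧
        (∀ x ∈ (S.residual.K.support : Set X), x ∉ (P : Set X) → IsEndNear S.residual.K 𝓛₀ x) ∧ HasContactFormOnPw₅ S (P : Set X)) :
    PhaseCOne CylReach.{u} :=
  phaseCOne_cylReach_of_frontEnd hLMG fun hX hXe S cyl _ _ hZreg hn 𝓒 𝓗 hfmt hreach => by
    obtain ⟨𝓛₀, P, hPK, hend, hform⟩ := hPiece hX hXe S cyl hZreg hn 𝓒 𝓗 hfmt hreach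
    refine ⟨𝓛₀, 1, fun _ => P, fun i k hik => absurd (Subsingleton.elim i k) hik, fun _ => hPK,
      fun x hx hxP => hend x hx (hxP 0), fun i U hPU _ => ?_⟩
    exact hCC _ hX hXe hreach.krullDimLE_four S P hPK hform U hPU

/-- [OURS · L1 W5.2 · F7(β) (β-AX) X3 C-I] **THE SAME ASSEMBLY OVER THE rev-6 CONTACT FORM (…X3DefsContact: carrier guards, stalkwise principal entries, carrier ≠ member at the stalk, patch-uniform carrier/entries/NF0; TARGETS OF RECORD, rev 6)**: `PhaseCOne CylReach` from
`LocallyMonomialGame`, `ContactCure₃Pw₆` and, per reachable format-snc state, one closed piece in contact form `HasContactFormOnPw₆` (…X3DefsContact) off which `K♭` is locally END. [cite: Kollar2007, (3.111) Step 3]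
[cite: CossartJannsenSaito2020, Thm. 1.4] -/
theorem phaseCOne_cylReach_of_contactCure₆ (hLMG : LocallyMonomialGame.{u}) (hCC : ContactCure₃Pw₆.{u})
    (hPiece : ∀ {X : Scheme.{u}} [IsNoetherian X], Scheme.IsRegular X → Scheme.IsExcellent X →
      ∀ (S : MultiHostState X) (cyl : CylState S) [IsIntegral cyl.Z] [IsNoetherian cyl.Z], Scheme.IsRegular cyl.Z → S.n ≠ 0 →
      ∀ (𝓒 : List X.IdealSheafData) (𝓗 : Fin S.n → List (X.IdealSheafData × ℕ)), S.IsFormatSncOn cyl.V 𝓒 𝓗 → CylReach S cyl →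
      ∃ (𝓛₀ : List X.IdealSheafData) (P : Closeds X), (P : Set X) ⊆ (S.residual.K.support : Set X) ∧
        (∀ x ∈ (S.residual.K.support : Set X), x ∉ (P : Set X) → IsEndNear S.residual.K 𝓛₀ x) ∧ HasContactFormOnPw₆ S (P : Set X)) :
    PhaseCOne CylReach.{u} :=
  phaseCOne_cylReach_of_frontEnd hLMG fun hX hXe S cyl _ _ hZreg hn 𝓒 𝓗 hfmt hreach => by
    obtain ⟨𝓛₀, P, hPK, hend, hform⟩ := hPiece hX hXe S cyl hZreg hn 𝓒 𝓗 hfmt hreach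
    refine ⟨𝓛₀, 1, fun _ => P, fun i k hik => absurd (Subsingleton.elim i k) hik, fun _ => hPK,
      fun x hx hxP => hend x hx (hxP 0), fun i U hPU _ => ?_⟩
    exact hCC _ hX hXe hreach.krullDimLE_four S P hPK hform U hPU

end Summit.ResolutionOfSingularities.ResolutionOfSingularities.Theorems.X3LemmaM

end
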